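import Literature.Analysis.FluidPDE.NSBoundedHigherRegularity
import Literature.Analysis.FluidPDE.SereginEpsilonRegularityHigher
import Literature.Analysis.FluidPDE.SuitableWeakInBallTools
import Literature.Analysis.FluidPDE.SereginSverakOffAxisTools
import Literature.Analysis.FluidPDE.PressureDecayEstimateProofs
import Literature.Analysis.FluidPDE.NSBoundedSuitableEnergy
import Literature.Analysis.FluidPDE.SereginSverakLocalEnergy
import HarnessLib

/-!
# Higher interior regularity of bounded Navier–Stokes solutions, reduced to ε-regularity with all derivatives

Proofs-only companion (no definitions, no new named facts) of `NSBoundedHigherRegularity.lean`,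
which vendors as the named fact `Literature.Analysis.FluidPDE.NSBoundedHigherRegularity` the
statement of G. Seregin, V. Šverák, *On Type I singularities of the local axi-symmetric
solutions of the Navier–Stokes equations*, Comm. PDE 34 (2009) 171–201 = arXiv:0804.1803, §2,
p. 8 (verbatim in Seregin 2014, §6.3, proof of Prop. 3.10, p. 107): inside the region where an
`L₃ × L_{3/2}` distributional solution is essentially bounded, "for any natural `k`,
`z = (x,t) ↦ ∇ᵏv(z)` is Hölder continuous in `Q̄₂` … Proof of this statements can be done by
induction and founded in [ESS4], [LS], and [NRS]". The higher-order ε-regularity lemma of those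
references — Escauriaza–Seregin–Šverák 2003, Lemma 2.2 = Nečas–Růžička–Šverák 1996, Prop. 2.1 =
Seregin 2014, Ch. 6, Lemma 6.1 — is the accepted named fact `seregin2014_lemma61`
(`SereginEpsilonRegularityHigher.lean`). This file PROVES

* `NSBoundedHigherRegularity.of_lemma61 : seregin2014_lemma61 → NSBoundedHigherRegularity`,

so that the trust base of `NSBoundedHigherRegularity` is the single unit-scale ε-regularity
lemma (as is already the case for its axisymmetric consumer
`SereginSverak2009.OffAxisSmoothRepresentative`, `SereginSverakOffAxisRegularity.lean`, whose
conclusion is interior: local Hölder continuity below the final time);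
`NSBoundedHigherRegularity_holds` will be the term
`NSBoundedHigherRegularity.of_lemma61 seregin2014_lemma61_holds` once that lemma is discharged.
What is specific here is the conclusion UP TO THE TOP TIME of `Q(z, r)` (uniform Hölder bounds on
`Q(z, r) = ]t - r², t[ × B(x, r)`, `r < R`, as printed: "Hölder continuous in `Q̄₂`"), which
requires the ε-regularity lemma at vertices ON the top boundary of `Q(z, R)`, hence the
square-integrability of `∇u` up to the top time (step 1 below).

## The argument (Seregin–Šverák 2009, §2 p. 6 and p. 8; Seregin 2014, p. 100 and p. 108)

Let `(u, p)` solve the system in `𝒟'(Q(z, R))` with `|u| ≤ M` a.e. and `p ∈ L_{3/2}(Q(z, R))`.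

1. *Suitability* ("the pair … is in fact a suitable weak solution", §2 p. 6): by the tree's
   `isSuitableWeakSolutionOn_of_bounded` (`NSBoundedSuitableEnergy.lean`) the pair is a suitable
   weak solution on the open cylinder; and it is in Albritton–Barker's class
   `IsSuitableWeakSolutionInBall ρ z₀` on every ball `Q(z₀, ρ)` hanging BELOW OR AT the top time
   with room `𝒞`-`Q(z₀, 2ρ) ⊆ Q(z, R)` (`isSuitableWeakSolutionInBall_of_bounded`): the energy
   class from the bound, and `∇u ∈ L²(Q(z₀, ρ))` up to the top time of the ball from the local
   energy estimate on cylinders whose top lies on the boundary (Seregin–Šverák (as12), the tree's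
   `SereginSverak2009.dissipationE_add_energyA_le_of_suitable`, `SereginSverakLocalEnergy.lean`).
2. *Smallness at a uniform scale.* For an outer radius `λ/4`, the decay estimate for the pressure
   ((as13), `seregin_sverak_pressure_decay_holds`, proved in the tree from Stein's
   Calderón–Zygmund bound) iterated along the scales `λσ^{2k}/4` (`cσ² ≤ 1/2`), fed with
   `C(r; z₀) ≤ M³r³|B₁|` (`cknC_le_of_ae_bound_subset`) and `D(λ/4; z₀) ≤ 16λ⁻²‖p‖^{3/2}_{3/2}`, yields an
   index `k₀` — through the tree's explicit majorant `SereginSverak2009.decayMajorant` /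
   `epsIndex` of the proof of Seregin–Zajaczkowski 2007, Lemma 2.3 — and a scale
   `ρ = λσ^{2k₀}/4`, the same for all vertices `z₀` with `Q(z₀, λ) ⊆ Q(z, R)`, at which
   `C(ρ; z₀) + D(ρ; z₀) ≤ ε₀/2` (`cknC_add_cknD_le_of_decay`).
3. *Lemma 6.1 at scale `ρ`* ("Lemma 6.1 and the Navier–Stokes scaling", Seregin 2014 p. 100):
   zoom to `Q(0, 1)`, apply the lemma, transport the representative back
   (`SuitableWeakInBallTools.lean`): a representative on `Q(z₀, ρ/2)` with `C^∞` slices, all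
   `D_xᵏ` Hölder in space–time and bounded by `ρ^{-(k+1)} c₀(k)`
   (`exists_smooth_representative_of_small`).
4. *Covering.* For `r < R` put `λ = (R - r)/2`; every point `q = (t', x')` of the closed box
   `[t - r², t] × B̄(x, r)` has the anchor `a = (min (t' + ρ²/8) t, x')` with `Q(a, λ) ⊆ Q(z, R)`
   (`anchor_subset`), every point of `Q(z, r)` lies in `Q(a, ρ/2)` for its own anchor, and a
   product neighbourhood of `q` meets `Q(z, r)` inside `Q(a, ρ/2)` (`anchor_nhds_inter_subset`) —
   this is where vertices AT the top time are needed. The local representatives glue to one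
   continuous representative of `u` on `Q(z, R)` (the tree's `exists_continuousOn_ae_eq_of_locally`),
   which coincides with each of them on its open cylinder (`Measure.eqOn_open_of_ae_eq`): the
   slices are `C^∞`, `D_xⁿ` is bounded on `Q(z, r)` by `ρ^{-(n+1)} c₀(n)`, locally Hölder around
   every point of the compact box, hence uniformly Hölder on `Q(z, r)`
   (`exists_holderOnWith_of_locally`: finite subcover, Lebesgue number, distant pairs by the bound).

## References

* G. Seregin, V. Šverák, Comm. PDE 34 (2009) 171–201 = arXiv:0804.1803: §2 p. 6 ((b8)–(b10),
  suitability), p. 8 (the statement), proof of Lemma 3.5 ((as12), (as13), p. 10), proof of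
  Prop. 3.7 (the iteration, p. 10). [`SereginSverak2009`]
* G. Seregin, *Lecture Notes on Regularity Theory for the Navier–Stokes Equations*, World
  Scientific 2014: Ch. 6 §6.1 Lemma 6.1 and Remark 6.1 (PDF p. 90), p. 100 (scaling), §6.3
  p. 107–108. [`Seregin2014`]
* L. Escauriaza, G. Seregin, V. Šverák, Russian Math. Surveys 58 (2003) 211–250, Lemma 2.2
  ([ESS4]). [`EscauriazaSereginSverak2003`]
* J. Nečas, M. Růžička, V. Šverák, Acta Math. 176 (1996) 283–294, Prop. 2.1 ([NRS]).
  [`NecasRuzickaSverak1996`]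
* G. Seregin, W. Zajaczkowski, SIAM J. Math. Anal. 39 (2007), arXiv:math/0702720, proof of
  Lemma 2.3 (the iteration). [`SereginZajaczkowski2007`]
* D. Albritton, T. Barker, J. Math. Fluid Mech. 21 (2019), Def. 2.1 (the class in parabolic
  balls). [`AlbrittonBarker2019`]
-/

noncomputable section

open MeasureTheory Set Function Filter Topology TopologicalSpace Metric
open scoped NNReal ENNReal ContDiff

namespace Literature.Analysis.FluidPDE

/-! ### A covering lemma: local Hölder bounds on a relatively compact set are uniform -/

section Covering

variable {X Y : Type*} [PseudoMetricSpace X] [NormedAddCommGroup Y]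

/-- **Local Hölder bounds glue on relatively compact sets.** Let `S ⊆ K` with `K` compact and let
`f` be bounded on `S`. If every point of `K` has an open neighbourhood `O` such that `f` is
uniformly Hölder on `O ∩ S` (some constant, some positive exponent), then `f` is uniformly Hölder
on `S` (finite subcover, Lebesgue number, smallest exponent; distant pairs by the bound).
[folklore] -/
theorem exists_holderOnWith_of_locally {K S : Set X} (hK : IsCompact K) (hSK : S ⊆ K)
    {f : X → Y} {B : ℝ} (hB : ∀ w ∈ S, ‖f w‖ ≤ B)
    (hloc : ∀ q ∈ K, ∃ O : Set X, IsOpen O ∧ q ∈ O ∧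
      ∃ C α : ℝ≥0, 0 < α ∧ HolderOnWith C α f (O ∩ S)) :
    ∃ C α : ℝ≥0, 0 < α ∧ HolderOnWith C α f S := by
  classical
  choose! O hOo hqO C α hα hH using hloc
  -- a finite subcover and a Lebesgue number
  obtain ⟨t, ht⟩ := hK.elim_finite_subcover (fun q : K => O q) (fun q => hOo q q.2)
    (fun q hq => mem_iUnion.2 ⟨⟨q, hq⟩, hqO q hq⟩)
  rcases t.eq_empty_or_nonempty with rfl | hne
  · have hS : S = ∅ := by
      refine eq_empty_of_subset_empty fun w hw => ?_
      simpa using ht (hSK hw)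
    refine ⟨0, 1, one_pos, ?_⟩
    rw [hS]
    exact holderOnWith_empty _ _ _
  obtain ⟨δ, hδ, hδc⟩ := lebesgue_number_lemma_of_metric hK (c := fun q : t => O ((q : K) : X))
    (fun q => hOo _ (q : K).2) (by
      intro w hw
      obtain ⟨q, hq, hw'⟩ := mem_iUnion₂.1 (ht hw)
      exact mem_iUnion.2 ⟨⟨q, hq⟩, hw'⟩)
  -- the smallest exponent and the sum of the constants over the subcover
  obtain ⟨q₀, hq₀, hmin⟩ := t.exists_min_image (fun q : K => α q) hne
  have hα₀pos : 0 < α q₀ := hα q₀ q₀.2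
  have hCle : ∀ q ∈ t, C (q : X) ≤ ∑ q' ∈ t, C (q' : X) := fun q hq =>
    Finset.single_le_sum (f := fun q' : K => C (q' : X)) (fun q' _ => (C (q' : X)).2) hq
  -- the constant for distant pairs
  set δ' : ℝ := min δ 1 with hδ'
  have hδ'pos : 0 < δ' := lt_min hδ one_pos
  have hδ'1 : δ' ≤ 1 := min_le_right _ _
  set B' : ℝ := max B 0 with hB'
  have hδpow : (0 : ℝ≥0) < δ'.toNNReal ^ ((α q₀ : ℝ≥0) : ℝ) :=
    NNReal.rpow_pos (Real.toNNReal_pos.2 hδ'pos)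
  set Cfar : ℝ≥0 := (2 * B').toNNReal * (δ'.toNNReal ^ ((α q₀ : ℝ≥0) : ℝ))⁻¹ with hCfar
  refine ⟨(∑ q ∈ t, C q) + Cfar, α q₀, hα₀pos, fun w hw w' hw' => ?_⟩
  by_cases hd : dist w w' < δ'
  · -- close pairs lie in a common member of the subcover
    obtain ⟨i, hi⟩ := hδc w (hSK hw)
    have hwO : w ∈ O ((i : K) : X) := hi (mem_ball_self hδ)
    have hw'O : w' ∈ O ((i : K) : X) := hi (mem_ball'.2 (hd.trans_le (min_le_left _ _)))
    have h1 := hH (i : K) (i : K).2 w ⟨hwO, hw⟩ w' ⟨hw'O, hw'⟩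
    have hed1 : edist w w' ≤ 1 := by
      rw [edist_dist]
      exact ENNReal.ofReal_le_one.2 (hd.le.trans hδ'1)
    have hαle : ((α q₀ : ℝ≥0) : ℝ) ≤ ((α (i : K) : ℝ≥0) : ℝ) := by exact_mod_cast hmin _ i.2
    calc edist (f w) (f w') ≤ (C (i : K) : ℝ≥0∞) * edist w w' ^ ((α (i : K) : ℝ≥0) : ℝ) := h1
      _ ≤ ((∑ q ∈ t, C q : ℝ≥0) : ℝ≥0∞) * edist w w' ^ ((α q₀ : ℝ≥0) : ℝ) :=
          mul_le_mul' (ENNReal.coe_le_coe.2 (hCle _ i.2))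
            (ENNReal.rpow_le_rpow_of_exponent_ge hed1 hαle)
      _ ≤ (((∑ q ∈ t, C q) + Cfar : ℝ≥0) : ℝ≥0∞) * edist w w' ^ ((α q₀ : ℝ≥0) : ℝ) :=
          mul_le_mul' (by exact_mod_cast le_self_add) le_rfl
  · -- distant pairs: use the bound
    have hd' : δ' ≤ dist w w' := not_lt.1 hd
    have hfar : edist (f w) (f w') ≤ ENNReal.ofReal (2 * B') := by
      rw [edist_dist, dist_eq_norm]
      refine ENNReal.ofReal_le_ofReal ?_
      calc ‖f w - f w'‖ ≤ ‖f w‖ + ‖f w'‖ := norm_sub_le _ _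
        _ ≤ B' + B' := add_le_add ((hB w hw).trans (le_max_left _ _))
            ((hB w' hw').trans (le_max_left _ _))
        _ = 2 * B' := by ring
    have hkey : ENNReal.ofReal (2 * B') ≤ (Cfar : ℝ≥0∞) * edist w w' ^ ((α q₀ : ℝ≥0) : ℝ) := by
      have e1 : ENNReal.ofReal (2 * B') =
          (Cfar : ℝ≥0∞) * ((δ'.toNNReal : ℝ≥0∞) ^ ((α q₀ : ℝ≥0) : ℝ)) := by
        rw [hCfar, ENNReal.coe_mul, ← ENNReal.coe_rpow_of_nonneg _ (α q₀).coe_nonneg, mul_assoc,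
          ← ENNReal.coe_mul, inv_mul_cancel₀ hδpow.ne', ENNReal.coe_one, mul_one]
        rfl
      rw [e1]
      refine mul_le_mul' le_rfl (ENNReal.rpow_le_rpow ?_ (α q₀).coe_nonneg)
      rw [edist_dist]
      exact ENNReal.ofReal_le_ofReal hd'
    calc edist (f w) (f w') ≤ ENNReal.ofReal (2 * B') := hfar
      _ ≤ (Cfar : ℝ≥0∞) * edist w w' ^ ((α q₀ : ℝ≥0) : ℝ) := hkey
      _ ≤ (((∑ q ∈ t, C q) + Cfar : ℝ≥0) : ℝ≥0∞) * edist w w' ^ ((α q₀ : ℝ≥0) : ℝ) :=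
          mul_le_mul' (by exact_mod_cast le_add_self) le_rfl

end Covering

/-! ### Geometry of backward cylinders and of the anchors -/

section Geometry

/-- Backward parabolic cylinders about a fixed vertex increase with the radius (`0 ≤ r ≤ r'`).
[folklore] -/
theorem parabolicCylinder_mono_radius {r r' : ℝ} (hr : 0 ≤ r) (h : r ≤ r') (z : ℝ × (EuclideanSpace ℝ (Fin 3))) :
    parabolicCylinder r z ⊆ parabolicCylinder r' z := by
  have h2 : r ^ 2 ≤ r' ^ 2 := pow_le_pow_left₀ hr h 2
  exact prod_mono (Ioo_subset_Ioo (by linarith) le_rfl) (ball_subset_ball h)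

/-- A criterion for `Q(a, ρ) ⊆ Q(z, R)`: later vertex time of `z`, earlier bottom, and
`B(a, ρ) ⊆ B(z, R)` by the triangle inequality. [folklore] -/
theorem parabolicCylinder_subset_of_margins {ρ R : ℝ} {a z : ℝ × (EuclideanSpace ℝ (Fin 3))} (h1 : a.1 ≤ z.1)
    (h2 : z.1 - R ^ 2 ≤ a.1 - ρ ^ 2) (h3 : dist a.2 z.2 + ρ ≤ R) :
    parabolicCylinder ρ a ⊆ parabolicCylinder R z := by
  intro w hw
  rw [mem_parabolicCylinder] at hw ⊢
  refine ⟨⟨by linarith [hw.1.1], lt_of_lt_of_le hw.1.2 h1⟩, ?_⟩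
  calc dist w.2 z.2 ≤ dist w.2 a.2 + dist a.2 z.2 := dist_triangle _ _ _
    _ < ρ + dist a.2 z.2 := by linarith [hw.2]
    _ ≤ R := by linarith

/-- Backward parabolic cylinders have finite volume. [folklore] -/
theorem parabolicCylinder_finite_volume (r : ℝ) (z : ℝ × (EuclideanSpace ℝ (Fin 3))) : volume (parabolicCylinder r z) < ⊤ :=
  ((Metric.isBounded_Ioo _ _).prod Metric.isBounded_ball).measure_lt_top

variable {z : ℝ × (EuclideanSpace ℝ (Fin 3))} {R r : ℝ}

/-- **The anchors.** For `0 < r < R`, a point `q` of the closed box `[t - r², t] × B̄(x, r)` and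
any `ρ`, the backward cylinder of radius `(R - r)/2` hanging from the anchor
`a = (min (q₁ + ρ²/8) t, q₂)` lies in `Q(z, R)` (`z = (t, x)`). [folklore] -/
theorem anchor_subset (hr : r ∈ Ioo 0 R) {q : ℝ × (EuclideanSpace ℝ (Fin 3))}
    (hq : q ∈ Icc (z.1 - r ^ 2) z.1 ×ˢ closedBall z.2 r) (ρ : ℝ) :
    parabolicCylinder ((R - r) / 2) (min (q.1 + ρ ^ 2 / 8) z.1, q.2) ⊆ parabolicCylinder R z := by
  obtain ⟨⟨hq1, hq2⟩, hq3⟩ := hq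
  rw [mem_closedBall] at hq3
  refine parabolicCylinder_subset_of_margins (min_le_right _ _) ?_ ?_
  · have hmin : q.1 ≤ min (q.1 + ρ ^ 2 / 8) z.1 := le_min (by nlinarith [sq_nonneg ρ]) hq2
    show z.1 - R ^ 2 ≤ min (q.1 + ρ ^ 2 / 8) z.1 - ((R - r) / 2) ^ 2
    nlinarith [hr.1, hr.2]
  · show dist q.2 z.2 + (R - r) / 2 ≤ R
    linarith [hr.2]

/-- A point of the open cylinder `Q(z, r)` lies in the cylinder of radius `ρ/2` hanging from its
own anchor. [folklore] -/
theorem mem_parabolicCylinder_anchor {w : ℝ × (EuclideanSpace ℝ (Fin 3))} (hw : w ∈ parabolicCylinder r z) {ρ : ℝ}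
    (hρ : 0 < ρ) : w ∈ parabolicCylinder (ρ / 2) (min (w.1 + ρ ^ 2 / 8) z.1, w.2) := by
  rw [mem_parabolicCylinder] at hw ⊢
  refine ⟨⟨?_, ?_⟩, by simpa using hρ⟩
  · show min (w.1 + ρ ^ 2 / 8) z.1 - (ρ / 2) ^ 2 < w.1
    have := min_le_left (w.1 + ρ ^ 2 / 8) z.1
    nlinarith
  · show w.1 < min (w.1 + ρ ^ 2 / 8) z.1
    exact lt_min (by nlinarith) hw.1.2

/-- The open neighbourhood `O(q) = ]a₁ - ρ²/4, q₁ + ρ²/8[ × B(q₂, ρ/2)` of a point `q` of the box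
(with `a` its anchor) meets `Q(z, r)` inside the anchor cylinder `Q(a, ρ/2)`. [folklore] -/
theorem anchor_nhds_inter_subset {q : ℝ × (EuclideanSpace ℝ (Fin 3))} (ρ : ℝ) :
    (Ioo (min (q.1 + ρ ^ 2 / 8) z.1 - (ρ / 2) ^ 2) (q.1 + ρ ^ 2 / 8) ×ˢ ball q.2 (ρ / 2)) ∩
        parabolicCylinder r z ⊆
      parabolicCylinder (ρ / 2) (min (q.1 + ρ ^ 2 / 8) z.1, q.2) := by
  rintro w ⟨⟨⟨hw1, hw2⟩, hw3⟩, hw⟩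
  rw [mem_parabolicCylinder] at hw ⊢
  exact ⟨⟨hw1, lt_min hw2 hw.1.2⟩, hw3⟩

/-- … and contains `q`. [folklore] -/
theorem mem_anchor_nhds (q : ℝ × (EuclideanSpace ℝ (Fin 3))) {ρ : ℝ} (hρ : 0 < ρ) :
    q ∈ Ioo (min (q.1 + ρ ^ 2 / 8) z.1 - (ρ / 2) ^ 2) (q.1 + ρ ^ 2 / 8) ×ˢ ball q.2 (ρ / 2) := by
  refine ⟨⟨?_, by nlinarith⟩, mem_ball_self (by positivity)⟩
  have := min_le_left (q.1 + ρ ^ 2 / 8) z.1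
  nlinarith

/-- Every point of the open cylinder `Q(z, R)` lies in some `Q(z, r)`, `0 < r < R`. [folklore] -/
theorem exists_mem_parabolicCylinder_lt {w : ℝ × (EuclideanSpace ℝ (Fin 3))} (hw : w ∈ parabolicCylinder R z) :
    ∃ r ∈ Ioo 0 R, w ∈ parabolicCylinder r z := by
  rw [mem_parabolicCylinder] at hw
  have hR : 0 < R := by
    have h0 : (0 : ℝ) ≤ dist w.2 z.2 := dist_nonneg
    linarith [hw.2]
  have h1 : max (dist w.2 z.2) (Real.sqrt (z.1 - w.1)) < R := by
    refine max_lt hw.2 ?_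
    rw [Real.sqrt_lt' hR]
    linarith [hw.1.1]
  obtain ⟨r, hr1, hr2⟩ := exists_between h1
  have hr0 : 0 < r := lt_of_le_of_lt (le_max_of_le_left dist_nonneg) hr1
  refine ⟨r, ⟨hr0, hr2⟩, ?_⟩
  rw [mem_parabolicCylinder]
  refine ⟨⟨?_, hw.1.2⟩, lt_of_le_of_lt (le_max_left _ _) hr1⟩
  have hs : Real.sqrt (z.1 - w.1) < r := lt_of_le_of_lt (le_max_right _ _) hr1
  rcases le_or_gt (z.1 - w.1) 0 with hzw | hzw
  · nlinarith
  · have := Real.lt_sq_of_sqrt_lt hs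
    linarith

end Geometry

/-! ### The scale-invariant functionals of bounded solutions -/

section Functionals

variable {u : ℝ → (EuclideanSpace ℝ (Fin 3)) → (EuclideanSpace ℝ (Fin 3))} {p : ℝ → (EuclideanSpace ℝ (Fin 3)) → ℝ}

/-- `C(r; z₀) ≤ M³ r³ |B₁|` when `|u| ≤ M` a.e. on a set containing `Q(z₀, r)`
(`|Q(z₀, r)| = r⁵ |B₁|`). [folklore] -/
theorem cknC_le_of_ae_bound_subset {S : Set (ℝ × (EuclideanSpace ℝ (Fin 3)))} {M : ℝ} (hM : 0 ≤ M)
    (hbd : ∀ᵐ w ∂(volume.restrict S), ‖u w.1 w.2‖ ≤ M) {z₀ : ℝ × (EuclideanSpace ℝ (Fin 3))} {r : ℝ} (hr : 0 < r)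
    (hsub : parabolicCylinder r z₀ ⊆ S) :
    cknC r z₀ u ≤ ENNReal.ofReal (M ^ 3 * r ^ 3) * volume (ball (0 : (EuclideanSpace ℝ (Fin 3))) 1) := by
  have hbd' : ∀ᵐ w ∂(volume.restrict (parabolicCylinder r z₀)),
      ‖u w.1 w.2‖ₑ ^ (3 : ℕ) ≤ ENNReal.ofReal M ^ 3 := by
    filter_upwards [ae_restrict_of_ae_restrict_of_subset hsub hbd] with w hw
    have h1 : ‖u w.1 w.2‖ₑ ≤ ENNReal.ofReal M := by
      rw [← ofReal_norm]
      exact ENNReal.ofReal_le_ofReal hw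
    gcongr
  have h1 : ∫⁻ w in parabolicCylinder r z₀, ‖u w.1 w.2‖ₑ ^ (3 : ℕ) ≤
      ENNReal.ofReal M ^ 3 * volume (parabolicCylinder r z₀) :=
    calc ∫⁻ w in parabolicCylinder r z₀, ‖u w.1 w.2‖ₑ ^ (3 : ℕ)
        ≤ ∫⁻ _ in parabolicCylinder r z₀, ENNReal.ofReal M ^ 3 := lintegral_mono_ae hbd'
      _ = ENNReal.ofReal M ^ 3 * volume (parabolicCylinder r z₀) := setLIntegral_const _ _
  have hr2 : ENNReal.ofReal (r ^ 2) ≠ 0 := (ENNReal.ofReal_pos.2 (by positivity)).ne'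
  rw [cknC]
  calc (ENNReal.ofReal r ^ 2)⁻¹ * ∫⁻ w in parabolicCylinder r z₀, ‖u w.1 w.2‖ₑ ^ (3 : ℕ)
      ≤ (ENNReal.ofReal r ^ 2)⁻¹ * (ENNReal.ofReal M ^ 3 * volume (parabolicCylinder r z₀)) :=
        mul_le_mul' le_rfl h1
    _ = ENNReal.ofReal (M ^ 3 * r ^ 3) * volume (ball (0 : (EuclideanSpace ℝ (Fin 3))) 1) := by
        rw [SereginSverak2009.volume_parabolicCylinder_eq z₀ hr.le, ← ENNReal.ofReal_pow hM,
          ← ENNReal.ofReal_pow hr.le, show r ^ 5 = r ^ 2 * r ^ 3 by ring,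
          ENNReal.ofReal_mul (by positivity), ENNReal.ofReal_mul (by positivity)]
        calc (ENNReal.ofReal (r ^ 2))⁻¹ * (ENNReal.ofReal (M ^ 3) *
              (ENNReal.ofReal (r ^ 2) * ENNReal.ofReal (r ^ 3) * volume (ball (0 : (EuclideanSpace ℝ (Fin 3))) 1)))
            = ((ENNReal.ofReal (r ^ 2))⁻¹ * ENNReal.ofReal (r ^ 2)) *
                (ENNReal.ofReal (M ^ 3) * ENNReal.ofReal (r ^ 3) * volume (ball (0 : (EuclideanSpace ℝ (Fin 3))) 1)) := by
              ring
          _ = ENNReal.ofReal (M ^ 3) * ENNReal.ofReal (r ^ 3) * volume (ball (0 : (EuclideanSpace ℝ (Fin 3))) 1) := by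
              rw [ENNReal.inv_mul_cancel hr2 ENNReal.ofReal_ne_top, one_mul]

/-- `D(r; z₀) ≤ r⁻² ∫_S |p|^{3/2}` for `Q(z₀, r) ⊆ S`. [folklore] -/
theorem cknD_le_inv_sq_mul_lintegral {S : Set (ℝ × (EuclideanSpace ℝ (Fin 3)))} {z₀ : ℝ × (EuclideanSpace ℝ (Fin 3))} {r : ℝ}
    (hsub : parabolicCylinder r z₀ ⊆ S) :
    cknD r z₀ p ≤ (ENNReal.ofReal r ^ 2)⁻¹ * ∫⁻ w in S, ‖p w.1 w.2‖ₑ ^ (3 / 2 : ℝ) :=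
  mul_le_mul' le_rfl (lintegral_mono_set hsub)

open SereginSverak2009 in
/-- **The smallness iteration** (the bookkeeping of Seregin–Zajaczkowski 2007, Lemma 2.3 =
Seregin–Šverák 2009, proof of Prop. 3.7, in the tree's form `decayMajorant` / `epsIndex`): if the
decay estimate for the pressure holds on `Q ⊇ Q(z₀, λ/4)` with constant `c`, `cσ² ≤ 1/2`, the
cubic functional satisfies `C(λ s_k²; z₀) ≤ a s_k` at the scales `s_k = σᵏ/2`, and
`D(λ/4; z₀) ≤ D₀`, then at the index `k₀ = epsIndex c σ η a D₀` the smallness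
`C + D ≤ η` holds at the scale `λ s_{k₀}²`. [cite: SereginZajaczkowski2007, proof of Lemma 2.3 (arXiv p. 3)] -/
theorem cknC_add_cknD_le_of_decay {Q : Set (ℝ × (EuclideanSpace ℝ (Fin 3)))} {c σ a D₀ η : ℝ≥0}
    (hdecay : ∀ (z₀ : ℝ × (EuclideanSpace ℝ (Fin 3))) (r ϱ : ℝ), 0 < ϱ → ϱ ≤ r → parabolicCylinder r z₀ ⊆ Q →
      cknD ϱ z₀ p ≤ c * (ENNReal.ofReal (ϱ / r) * cknD r z₀ p +
        ENNReal.ofReal ((r / ϱ) ^ 2) * cknC r z₀ u))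
    (hσ0 : 0 < σ) (hσ1 : σ < 1) (hcσ : c * σ ^ 2 ≤ 1 / 2) (hη : 0 < η) {z₀ : ℝ × (EuclideanSpace ℝ (Fin 3))} {lam : ℝ}
    (hlam : 0 < lam) (hsub : parabolicCylinder (lam / 4) z₀ ⊆ Q)
    (hC : ∀ k, cknC (lam * ((epsHalfScale σ k : ℝ≥0) : ℝ) ^ 2) z₀ u ≤
      ((a * epsHalfScale σ k : ℝ≥0) : ℝ≥0∞))
    (hD : cknD (lam / 4) z₀ p ≤ D₀) :
    cknC (lam * ((epsHalfScale σ (epsIndex c σ η a D₀) : ℝ≥0) : ℝ) ^ 2) z₀ u +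
      cknD (lam * ((epsHalfScale σ (epsIndex c σ η a D₀) : ℝ≥0) : ℝ) ^ 2) z₀ p ≤ η := by
  have hsk := fun k => epsHalfScale_pos_sq_le hσ0 hσ1 k
  have hσR : (0 : ℝ) < σ := by exact_mod_cast hσ0
  have hσ1R : (σ : ℝ) ≤ 1 := by exact_mod_cast hσ1.le
  -- the cylinders at the scales `λ s_k²` lie in `Q`
  have hsubk : ∀ k, parabolicCylinder (lam * ((epsHalfScale σ k : ℝ≥0) : ℝ) ^ 2) z₀ ⊆ Q := by
    intro k
    refine (parabolicCylinder_mono_radius (by positivity) ?_ z₀).trans hsub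
    have := (hsk k).2
    nlinarith
  -- `D(λ s_k²; z₀) ≤ g_k`
  have hDk : ∀ k, cknD (lam * ((epsHalfScale σ k : ℝ≥0) : ℝ) ^ 2) z₀ p ≤
      (decayMajorant c σ a D₀ k : ℝ≥0∞) := by
    intro k
    induction k with
    | zero =>
      have e0 : lam * ((epsHalfScale σ 0 : ℝ≥0) : ℝ) ^ 2 = lam / 4 := by
        simp [epsHalfScale]
        ring
      rw [e0]
      exact hD
    | succ k ih =>
      obtain ⟨hs0, hs4⟩ := hsk k
      set s : ℝ := ((epsHalfScale σ k : ℝ≥0) : ℝ) with hs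
      have e1 : ((epsHalfScale σ (k + 1) : ℝ≥0) : ℝ) = σ * s := by
        simp [hs, epsHalfScale, pow_succ]
        ring
      have hϱ : 0 < lam * (σ * s) ^ 2 := by positivity
      have hle : lam * (σ * s) ^ 2 ≤ lam * s ^ 2 := by
        have : (σ * s) ^ 2 ≤ s ^ 2 :=
          pow_le_pow_left₀ (by positivity) (mul_le_of_le_one_left hs0.le hσ1R) 2
        exact mul_le_mul_of_nonneg_left this hlam.le
      have h := hdecay z₀ (lam * s ^ 2) (lam * (σ * s) ^ 2) hϱ hle (hsubk k)
      have e2 : lam * (σ * s) ^ 2 / (lam * s ^ 2) = (σ : ℝ) ^ 2 := by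
        field_simp
      have e3 : (lam * s ^ 2 / (lam * (σ * s) ^ 2)) ^ 2 = ((σ : ℝ) ^ 4)⁻¹ := by
        field_simp
      rw [e2, e3, show ENNReal.ofReal ((σ : ℝ) ^ 2) = ((σ ^ 2 : ℝ≥0) : ℝ≥0∞) by
          rw [← NNReal.coe_pow, ENNReal.ofReal_coe_nnreal],
        show ENNReal.ofReal (((σ : ℝ) ^ 4)⁻¹) = (((σ ^ 4)⁻¹ : ℝ≥0) : ℝ≥0∞) by
          rw [← NNReal.coe_pow, ← NNReal.coe_inv, ENNReal.ofReal_coe_nnreal]] at h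
      rw [e1, decayMajorant_succ]
      exact decay_step_ennreal hcσ h ih (hC k)
  -- smallness at `k₀`
  have hspec := epsIndex_spec c a D₀ hσ1 hη
  set k₀ := epsIndex c σ η a D₀ with hk₀
  calc cknC (lam * ((epsHalfScale σ k₀ : ℝ≥0) : ℝ) ^ 2) z₀ u +
        cknD (lam * ((epsHalfScale σ k₀ : ℝ≥0) : ℝ) ^ 2) z₀ p
      ≤ ((a * epsHalfScale σ k₀ : ℝ≥0) : ℝ≥0∞) + (decayMajorant c σ a D₀ k₀ : ℝ≥0∞) :=
        add_le_add (hC k₀) (hDk k₀)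
    _ ≤ η := by
        rw [add_comm]
        exact_mod_cast hspec

end Functionals

/-! ### Bounded solutions are suitable in the parabolic balls hanging below the top time -/

section InBall

variable {u : ℝ → (EuclideanSpace ℝ (Fin 3)) → (EuclideanSpace ℝ (Fin 3))} {p : ℝ → (EuclideanSpace ℝ (Fin 3)) → ℝ} {G : ℝ → (EuclideanSpace ℝ (Fin 3)) → (EuclideanSpace ℝ (Fin 3)) →L[ℝ] (EuclideanSpace ℝ (Fin 3))} {z : ℝ × (EuclideanSpace ℝ (Fin 3))} {R M : ℝ}

/-- For an essentially bounded field, `|u|³` is integrable on the (bounded) cylinder. [folklore] -/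
theorem integrableOn_norm_pow_three_of_ae_bound
    (hu : AEStronglyMeasurable (uncurry u) (volume.restrict (parabolicCylinder R z)))
    (hbd : ∀ᵐ w ∂(volume.restrict (parabolicCylinder R z)), ‖u w.1 w.2‖ ≤ M) :
    IntegrableOn (fun w : ℝ × (EuclideanSpace ℝ (Fin 3)) => ‖u w.1 w.2‖ ^ 3) (parabolicCylinder R z) volume := by
  haveI : IsFiniteMeasure (volume.restrict (parabolicCylinder R z)) :=
    ⟨by rw [Measure.restrict_apply_univ]; exact parabolicCylinder_finite_volume R z⟩
  refine Integrable.of_bound (hu.norm.pow 3) (max M 0 ^ 3) ?_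
  filter_upwards [hbd] with w hw
  rw [Real.norm_eq_abs, abs_pow, abs_norm]
  exact pow_le_pow_left₀ (norm_nonneg _) (hw.trans (le_max_left _ _)) 3

/-- **The gradient is square integrable up to the top time** (the local energy estimate on
cylinders whose top lies on the boundary of the domain, Seregin–Šverák 2009, (as12), proved in
the tree as `SereginSverak2009.dissipationE_add_energyA_le_of_suitable`): for a suitable weak
solution on `Q(z, R)` with `|u| ≤ M` a.e. and `p ∈ L^{3/2}(Q(z, R))`, every weak spatial gradient
`G` of `u` satisfies `∫∫_{Q(z₀, ρ)} |G|² < ∞` as soon as Seregin–Šverák's coordinate cylinder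
`𝒞`-`Q(z₀, 2ρ)` lies in `Q(z, R)` — in particular for vertices `z₀` AT the top time of `Q(z, R)`.
[cite: SereginSverak2009, proof of Lemma 3.5, (as12)] -/
theorem lintegral_frobeniusNormSq_lt_top_of_bounded
    (hsuit : IsSuitableWeakSolutionOn (parabolicCylinderOpens R z) 1 0 u p)
    (hG : HasWeakSpatialGradientOn (parabolicCylinderOpens R z) u G)
    (hbd : ∀ᵐ w ∂(volume.restrict (parabolicCylinder R z)), ‖u w.1 w.2‖ ≤ M)
    (hp : ∫⁻ w in parabolicCylinder R z, ‖p w.1 w.2‖ₑ ^ (3 / 2 : ℝ) < ⊤)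
    {z₀ : ℝ × (EuclideanSpace ℝ (Fin 3))} {ρ : ℝ} (hρ : 0 < ρ)
    (hsub : SereginSverak2009.parCyl z₀ (2 * ρ) ⊆ parabolicCylinder R z) :
    ∫⁻ w in parabolicCylinder ρ z₀, ENNReal.ofReal (frobeniusNormSq (G w.1 w.2)) < ⊤ := by
  obtain ⟨cE, hcE⟩ := SereginSverak2009.dissipationE_add_energyA_le_of_suitable
  have hum : AEStronglyMeasurable (uncurry u) (volume.restrict (parabolicCylinder R z)) :=
    hsuit.distributional.1.aestronglyMeasurable
  have hu3 : LocallyIntegrableOn (fun w : ℝ × (EuclideanSpace ℝ (Fin 3)) => ‖u w.1 w.2‖ ^ 3)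
      ((parabolicCylinderOpens R z : Opens (ℝ × (EuclideanSpace ℝ (Fin 3)))) : Set (ℝ × (EuclideanSpace ℝ (Fin 3)))) volume :=
    (integrableOn_norm_pow_three_of_ae_bound hum hbd).locallyIntegrableOn
  have h := hcE (parabolicCylinderOpens R z) u p G hsuit hu3 hG z₀ (2 * ρ) (by positivity) hsub
  rw [show (2 : ℝ) * ρ / 2 = ρ by ring] at h
  -- the right-hand side is finite
  have hvol : volume (SereginSverak2009.parCyl z₀ (2 * ρ)) < ⊤ :=
    lt_of_le_of_lt (measure_mono hsub) (parabolicCylinder_finite_volume R z)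
  have hCfin : SereginSverak2009.cubicC z₀ (2 * ρ) u < ⊤ := by
    have hbd' : ∀ᵐ w ∂(volume.restrict (SereginSverak2009.parCyl z₀ (2 * ρ))),
        ‖u w.1 w.2‖ₑ ^ (3 : ℕ) ≤ ENNReal.ofReal (max M 0) ^ 3 := by
      filter_upwards [ae_restrict_of_ae_restrict_of_subset hsub hbd] with w hw
      have h1 : ‖u w.1 w.2‖ₑ ≤ ENNReal.ofReal (max M 0) := by
        rw [← ofReal_norm]
        exact ENNReal.ofReal_le_ofReal (hw.trans (le_max_left _ _))
      gcongr
    have h1 : ∫⁻ w in SereginSverak2009.parCyl z₀ (2 * ρ), ‖u w.1 w.2‖ₑ ^ (3 : ℕ) ≤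
        ENNReal.ofReal (max M 0) ^ 3 * volume (SereginSverak2009.parCyl z₀ (2 * ρ)) :=
      calc ∫⁻ w in SereginSverak2009.parCyl z₀ (2 * ρ), ‖u w.1 w.2‖ₑ ^ (3 : ℕ)
          ≤ ∫⁻ _ in SereginSverak2009.parCyl z₀ (2 * ρ), ENNReal.ofReal (max M 0) ^ 3 :=
            lintegral_mono_ae hbd'
        _ = _ := setLIntegral_const _ _
    refine ENNReal.mul_lt_top (ENNReal.inv_lt_top.2 (by positivity)) ?_
    exact lt_of_le_of_lt h1 (ENNReal.mul_lt_top (ENNReal.pow_lt_top ENNReal.ofReal_lt_top) hvol)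
  have hDfin : SereginSverak2009.pressureD z₀ (2 * ρ) p < ⊤ := by
    refine ENNReal.mul_lt_top (ENNReal.inv_lt_top.2 (by positivity)) ?_
    exact lt_of_le_of_lt (lintegral_mono_set hsub) hp
  have hRHS : (cE : ℝ≥0∞) * (SereginSverak2009.cubicC z₀ (2 * ρ) u ^ (2 / 3 : ℝ) +
      SereginSverak2009.cubicC z₀ (2 * ρ) u + SereginSverak2009.pressureD z₀ (2 * ρ) p) < ⊤ := by
    refine ENNReal.mul_lt_top ENNReal.coe_lt_top ?_
    refine ENNReal.add_lt_top.2 ⟨ENNReal.add_lt_top.2 ⟨?_, hCfin⟩, hDfin⟩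
    exact ENNReal.rpow_lt_top_of_nonneg (by norm_num) hCfin.ne
  have hE : SereginSverak2009.dissipationE z₀ ρ G < ⊤ := lt_of_le_of_lt le_self_add (h.trans_lt hRHS)
  -- hence the integral over the coordinate cylinder, hence over the ball cylinder, is finite
  have hρ0 : ENNReal.ofReal ρ ≠ 0 := (ENNReal.ofReal_pos.2 hρ).ne'
  have hI : ∫⁻ w in SereginSverak2009.parCyl z₀ ρ, ENNReal.ofReal (frobeniusNormSq (G w.1 w.2)) < ⊤ := by
    have e : ∫⁻ w in SereginSverak2009.parCyl z₀ ρ, ENNReal.ofReal (frobeniusNormSq (G w.1 w.2)) =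
        ENNReal.ofReal ρ * SereginSverak2009.dissipationE z₀ ρ G := by
      rw [SereginSverak2009.dissipationE, ← mul_assoc, ENNReal.mul_inv_cancel hρ0 ENNReal.ofReal_ne_top,
        one_mul]
    rw [e]
    exact ENNReal.mul_lt_top ENNReal.ofReal_lt_top hE
  exact lt_of_le_of_lt (lintegral_mono_set (parabolicCylinder_subset_parCyl z₀ ρ)) hI

/-- `Q(z₀, 2√2 ρ)`-type comparison: the coordinate cylinder `𝒞`-`Q(z₀, 2ρ)` lies in the ball
cylinder `Q(z₀, λ)` once `0 < ρ` and `4ρ ≤ λ` (`2√2 < 4`). [folklore] -/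
theorem parCyl_two_mul_subset {z₀ : ℝ × (EuclideanSpace ℝ (Fin 3))} {ρ lam : ℝ} (hρ : 0 < ρ) (h : 4 * ρ ≤ lam) :
    SereginSverak2009.parCyl z₀ (2 * ρ) ⊆ parabolicCylinder lam z₀ := by
  refine (parCyl_subset_parabolicCylinder z₀ (by positivity : (0 : ℝ) ≤ 2 * ρ)).trans
    (parabolicCylinder_mono_radius (by positivity) ?_ z₀)
  have hs : Real.sqrt 2 ≤ 2 := by
    rw [Real.sqrt_le_left (by norm_num : (0 : ℝ) ≤ 2)]
    norm_num
  nlinarith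

/-- **Bounded distributional solutions are suitable in the parabolic balls hanging below the top
time** (Albritton–Barker's class `IsSuitableWeakSolutionInBall`): the local notion restricts, the
energy class comes from the bound, the pressure class from `p ∈ L^{3/2}`, and the global
square-integrability of the gradient on the ball — up to its top time — from
`lintegral_frobeniusNormSq_lt_top_of_bounded`. [cite: SereginSverak2009, §2 p. 6 ("in fact a suitable weak solution")] -/
theorem isSuitableWeakSolutionInBall_of_bounded
    (hsuit : IsSuitableWeakSolutionOn (parabolicCylinderOpens R z) 1 0 u p)
    (hG : HasWeakSpatialGradientOn (parabolicCylinderOpens R z) u G)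
    (hbd : ∀ᵐ w ∂(volume.restrict (parabolicCylinder R z)), ‖u w.1 w.2‖ ≤ M)
    (hp : ∫⁻ w in parabolicCylinder R z, ‖p w.1 w.2‖ₑ ^ (3 / 2 : ℝ) < ⊤)
    {z₀ : ℝ × (EuclideanSpace ℝ (Fin 3))} {ρ : ℝ} (hρ : 0 < ρ)
    (hsub : SereginSverak2009.parCyl z₀ (2 * ρ) ⊆ parabolicCylinder R z) :
    IsSuitableWeakSolutionInBall ρ z₀ u p := by
  have hsub' : parabolicCylinder ρ z₀ ⊆ parabolicCylinder R z :=
    (parabolicCylinder_subset_parCyl z₀ ρ).trans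
      ((SereginSverak2009.parCyl_mono z₀ hρ.le (by linarith)).trans hsub)
  have hle : parabolicCylinderOpens ρ z₀ ≤ parabolicCylinderOpens R z := hsub'
  refine ⟨hsuit.of_le hle, ?_, ⟨G, hG.mono hle,
    lintegral_frobeniusNormSq_lt_top_of_bounded hsuit hG hbd hp hρ hsub⟩, ?_⟩
  · -- the energy class from the bound
    set C : ℝ≥0∞ := ENNReal.ofReal (max M 0) ^ 2 * volume (ball z₀.2 ρ) with hC
    have hCtop : C ≠ ⊤ := ENNReal.mul_ne_top (ENNReal.pow_ne_top ENNReal.ofReal_ne_top)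
      measure_ball_lt_top.ne
    refine ⟨C.toNNReal, ?_⟩
    rw [ENNReal.coe_toNNReal hCtop]
    have h1 : ∀ᵐ w ∂(volume.restrict (Ioo (z₀.1 - ρ ^ 2) z₀.1 ×ˢ ball z₀.2 ρ)), ‖u w.1 w.2‖ ≤ M :=
      ae_restrict_of_ae_restrict_of_subset hsub' hbd
    have h2 : ∀ᵐ t ∂(volume.restrict (Ioo (z₀.1 - ρ ^ 2) z₀.1)),
        ∀ᵐ x ∂(volume.restrict (ball z₀.2 ρ)), ‖u (t, x).1 (t, x).2‖ ≤ M := by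
      rw [Measure.volume_eq_prod, ← Measure.prod_restrict] at h1
      exact Measure.ae_ae_of_ae_prod h1
    filter_upwards [h2] with t ht
    calc ∫⁻ x in ball z₀.2 ρ, ‖u t x‖ₑ ^ 2 ≤ ∫⁻ _ in ball z₀.2 ρ, ENNReal.ofReal (max M 0) ^ 2 := by
          refine lintegral_mono_ae ?_
          filter_upwards [ht] with x hx
          have h3 : ‖u t x‖ₑ ≤ ENNReal.ofReal (max M 0) := by
            rw [← ofReal_norm]
            exact ENNReal.ofReal_le_ofReal (hx.trans (le_max_left _ _))
          gcongr
      _ = C := setLIntegral_const _ _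
  · -- the pressure class
    have hmeas : AEStronglyMeasurable (uncurry p) (volume.restrict (parabolicCylinder ρ z₀)) :=
      (hsuit.distributional.2.2.1.aestronglyMeasurable).mono_measure
        (Measure.restrict_mono hsub' le_rfl)
    refine ⟨hmeas, ?_⟩
    have h32 : ((3 : ℝ≥0∞) / 2).toReal = 3 / 2 := by
      rw [ENNReal.toReal_div]; norm_num
    have h32top : (3 : ℝ≥0∞) / 2 ≠ ⊤ := (ENNReal.div_lt_top (by simp) (by simp)).ne
    rw [eLpNorm_eq_lintegral_rpow_enorm_toReal (by norm_num) h32top, h32]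
    refine ENNReal.rpow_lt_top_of_nonneg (by positivity) (ne_of_lt ?_)
    exact (lintegral_mono_set hsub').trans_lt hp

end InBall

/-! ### Lemma 6.1 at scale `ρ` -/

section LocalRep

variable {u : ℝ → (EuclideanSpace ℝ (Fin 3)) → (EuclideanSpace ℝ (Fin 3))} {p : ℝ → (EuclideanSpace ℝ (Fin 3)) → ℝ}

/-- **Seregin 2014, Lemma 6.1, at scale `ρ`** ("Lemma 6.1 and the Navier–Stokes scaling", p. 100):
if `(u, p)` is suitable in the ball `Q(z₀, ρ)` and `C(ρ; z₀) + D(ρ; z₀) < ε₀`, the zoomed pair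
`U = ρ u ∘ Φ`, `P = ρ² p ∘ Φ` is suitable in `Q(0, 1)` with `∫_{Q(0,1)} (|U|³ + |P|^{3/2}) < ε₀`
(`IsSuitableWeakSolutionInBall.zoom`, `lintegral_cube_zoom`, `lintegral_pressure_zoom`), the
conclusion of Lemma 6.1 (here a hypothesis `h61`, the body of the named fact
`seregin2014_lemma61`) applies, and its representative is transported back to `Q(z₀, ρ/2)`
(`exists_representative_of_zoom`), with the bounds `‖D_xᵏV‖ ≤ ρ^{-(k+1)} c₀(k)`.
[cite: Seregin2014, Ch. 6 §6.1 Lemma 6.1, PDF p. 90, with p. 100 (scaling)] -/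
theorem exists_smooth_representative_of_small {ε₀ : ℝ} {c₀ : ℕ → ℝ}
    (h61 : ∀ (U : ℝ → (EuclideanSpace ℝ (Fin 3)) → (EuclideanSpace ℝ (Fin 3))) (P : ℝ → (EuclideanSpace ℝ (Fin 3)) → ℝ), IsSuitableWeakSolutionInBall 1 0 U P →
      ∫⁻ w in parabolicCylinder 1 (0 : ℝ × (EuclideanSpace ℝ (Fin 3))),
          (‖U w.1 w.2‖ₑ ^ (3 : ℕ) + ‖P w.1 w.2‖ₑ ^ (3 / 2 : ℝ)) < ENNReal.ofReal ε₀ →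
      ∃ W : ℝ → (EuclideanSpace ℝ (Fin 3)) → (EuclideanSpace ℝ (Fin 3)),
        uncurry U =ᵐ[volume.restrict (parabolicCylinder (1 / 2) (0 : ℝ × (EuclideanSpace ℝ (Fin 3))))] uncurry W ∧
        (∀ w ∈ parabolicCylinder (1 / 2) (0 : ℝ × (EuclideanSpace ℝ (Fin 3))), ContDiffAt ℝ ∞ (W w.1) w.2) ∧
        ∀ k : ℕ,
          (∃ C α : ℝ≥0, 0 < α ∧
            HolderOnWith C α (fun w : ℝ × (EuclideanSpace ℝ (Fin 3)) => iteratedFDeriv ℝ k (W w.1) w.2)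
              (parabolicCylinder (1 / 2) (0 : ℝ × (EuclideanSpace ℝ (Fin 3))))) ∧
          ∀ w ∈ parabolicCylinder (1 / 2) (0 : ℝ × (EuclideanSpace ℝ (Fin 3))), ‖iteratedFDeriv ℝ k (W w.1) w.2‖ ≤ c₀ k)
    {z₀ : ℝ × (EuclideanSpace ℝ (Fin 3))} {ρ : ℝ} (hρ : 0 < ρ) (hball : IsSuitableWeakSolutionInBall ρ z₀ u p)
    (hsmall : cknC ρ z₀ u + cknD ρ z₀ p < ENNReal.ofReal ε₀) :
    ∃ V : ℝ → (EuclideanSpace ℝ (Fin 3)) → (EuclideanSpace ℝ (Fin 3)),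
      uncurry u =ᵐ[volume.restrict (parabolicCylinder (ρ / 2) z₀)] uncurry V ∧
      (∀ w ∈ parabolicCylinder (ρ / 2) z₀, ContDiffAt ℝ ∞ (V w.1) w.2) ∧
      (∀ k : ℕ, ∃ C α : ℝ≥0, 0 < α ∧
        HolderOnWith C α (fun w : ℝ × (EuclideanSpace ℝ (Fin 3)) => iteratedFDeriv ℝ k (V w.1) w.2)
          (parabolicCylinder (ρ / 2) z₀)) ∧
      ∀ k : ℕ, ∀ w ∈ parabolicCylinder (ρ / 2) z₀,
        ‖iteratedFDeriv ℝ k (V w.1) w.2‖ ≤ ρ⁻¹ ^ (k + 1) * c₀ k := by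
  have hz := hball.zoom hρ
  have hUm : AEMeasurable
      (fun w : ℝ × (EuclideanSpace ℝ (Fin 3)) => ‖(ρ • stPull (ρ ^ 2) ρ z₀.1 z₀.2 u) w.1 w.2‖ₑ ^ (3 : ℕ))
      (volume.restrict (parabolicCylinder 1 (0 : ℝ × (EuclideanSpace ℝ (Fin 3))))) :=
    hz.1.distributional.1.aestronglyMeasurable.enorm.pow_const _
  have hsmall' : ∫⁻ w in parabolicCylinder 1 (0 : ℝ × (EuclideanSpace ℝ (Fin 3))),
      (‖(ρ • stPull (ρ ^ 2) ρ z₀.1 z₀.2 u) w.1 w.2‖ₑ ^ (3 : ℕ) +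
        ‖(ρ ^ 2 • stPull (ρ ^ 2) ρ z₀.1 z₀.2 p) w.1 w.2‖ₑ ^ (3 / 2 : ℝ)) < ENNReal.ofReal ε₀ := by
    rw [lintegral_add_left' hUm, lintegral_cube_zoom hρ z₀ u, lintegral_pressure_zoom hρ z₀ p]
    exact hsmall
  obtain ⟨W, hae, hcd, hk⟩ := h61 _ _ hz hsmall'
  exact exists_representative_of_zoom hρ z₀ hae hcd (fun k => (hk k).1) (fun k => (hk k).2)

end LocalRep

/-! ### The reduction -/

section Main

open SereginSverak2009 in
/-- **Higher interior regularity of bounded solutions from ε-regularity with all derivatives**: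
`seregin2014_lemma61 → NSBoundedHigherRegularity`. Given a distributional solution on
`Q(z, R)` with `|u| ≤ M` a.e. and `p ∈ L^{3/2}`: it is a suitable weak solution there
(`isSuitableWeakSolutionOn_of_bounded`) and in every ball `Q(z₀, ρ)` hanging below the top time
with room `𝒞`-`Q(z₀, 2ρ) ⊆ Q(z, R)` (`isSuitableWeakSolutionInBall_of_bounded`); for an outer
radius `λ/4` the decay estimate for the pressure (`seregin_sverak_pressure_decay_holds`) iterated
along the scales `λ σ^{2k}/4` with `C ≤ M³ r³ |B₁|` gives a scale `ρ = scale λ ≤ λ/4`, THE SAME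
FOR ALL VERTICES `z₀` with `Q(z₀, λ) ⊆ Q(z, R)`, at which `C(ρ; z₀) + D(ρ; z₀) ≤ ε₀/2`
(`cknC_add_cknD_le_of_decay`); Lemma 6.1 at scale `ρ` gives a smooth local representative on
`Q(z₀, ρ/2)` with `‖D_xᵏ‖ ≤ ρ^{-(k+1)} c₀(k)` (`exists_smooth_representative_of_small`). Every
point of `Q(z, r)`, `r < R`, and of its closed box lies in such a cylinder hanging from its
anchor `(min (t' + ρ²/8) t, x')` with `λ = (R - r)/2` (`anchor_subset`); the local representatives
glue to one continuous representative (`exists_continuousOn_ae_eq_of_locally`) which agrees with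
each of them on its open cylinder (`Measure.eqOn_open_of_ae_eq`), whence the smooth slices, and
the local Hölder bounds become uniform on `Q(z, r)` by compactness of the box
(`exists_holderOnWith_of_locally`, the uniform sup bound serving distant pairs).
[cite: SereginSverak2009, §2 p. 8 (regularity inside the region of essential boundedness, "founded in [ESS4], [LS], and [NRS]"); Seregin2014 Ch. 6 Lemma 6.1 (PDF p. 90)] -/
theorem NSBoundedHigherRegularity.of_lemma61 (hL : seregin2014_lemma61) :
    NSBoundedHigherRegularity := by
  intro u p z R M hsol hbd hp
  rcases le_or_gt R 0 with hR0 | hR0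
  · refine ⟨u, EventuallyEq.rfl, fun w hw => ?_, fun n r hr => ?_⟩
    · rw [parabolicCylinder_eq_empty hR0] at hw
      exact hw.elim
    · exact absurd (hr.1.trans hr.2) (not_lt.2 hR0)
  -- the data
  obtain ⟨ε₀, hε₀, c₀, h61⟩ := hL
  have hsuit : IsSuitableWeakSolutionOn (parabolicCylinderOpens R z) 1 0 u p :=
    isSuitableWeakSolutionOn_of_bounded one_pos hsol (parabolicCylinder_finite_volume R z) hbd hp
  obtain ⟨G, hG, -, -⟩ := hsuit.localEnergy
  obtain ⟨c, hc⟩ := seregin_sverak_pressure_decay_holds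
  have hdecay := hc (parabolicCylinderOpens R z) u p hsol
  obtain ⟨σ, hσ0, hσ1, hcσ⟩ := exists_ratio_sq c
  set η : ℝ≥0 := (ε₀ / 2).toNNReal with hη
  have hη0 : 0 < η := Real.toNNReal_pos.2 (half_pos hε₀)
  have hηε : (η : ℝ≥0∞) < ENNReal.ofReal ε₀ := by
    show ENNReal.ofReal (ε₀ / 2) < ENNReal.ofReal ε₀
    exact (ENNReal.ofReal_lt_ofReal_iff hε₀).2 (by linarith)
  set M' : ℝ := max M 0 with hM'
  have hM'0 : 0 ≤ M' := le_max_right _ _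
  have hbd' : ∀ᵐ w ∂(volume.restrict (parabolicCylinder R z)), ‖u w.1 w.2‖ ≤ M' :=
    hbd.mono fun w hw => hw.trans (le_max_left _ _)
  set Pp : ℝ≥0∞ := ∫⁻ w in parabolicCylinder R z, ‖p w.1 w.2‖ₑ ^ (3 / 2 : ℝ) with hPp
  set B₁ : ℝ≥0∞ := volume (ball (0 : (EuclideanSpace ℝ (Fin 3))) 1) with hB₁
  have hB₁top : B₁ ≠ ⊤ := measure_ball_lt_top.ne
  -- the data of the iteration for the outer radius `λ/4`, and the uniform scale
  set aC : ℝ → ℝ≥0 := fun lam => (M' ^ 3 * lam ^ 3).toNNReal * B₁.toNNReal with haC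
  set D₀ : ℝ → ℝ≥0 := fun lam => ((ENNReal.ofReal (lam / 4) ^ 2)⁻¹ * Pp).toNNReal with hD₀
  set scale : ℝ → ℝ := fun lam =>
    lam * ((epsHalfScale σ (epsIndex c σ η (aC lam) (D₀ lam)) : ℝ≥0) : ℝ) ^ 2 with hscale
  have hscale_pos : ∀ lam, 0 < lam → 0 < scale lam := fun lam hlam => by
    have := (epsHalfScale_pos_sq_le hσ0 hσ1 (epsIndex c σ η (aC lam) (D₀ lam))).1
    simp only [hscale]
    positivity
  have hscale_le : ∀ lam, 0 < lam → 4 * scale lam ≤ lam := fun lam hlam => by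
    have := (epsHalfScale_pos_sq_le hσ0 hσ1 (epsIndex c σ η (aC lam) (D₀ lam))).2
    simp only [hscale]
    nlinarith
  -- KEY: local smooth representatives at the uniform scale
  have key : ∀ lam : ℝ, 0 < lam → ∀ z₀ : ℝ × (EuclideanSpace ℝ (Fin 3)),
      parabolicCylinder lam z₀ ⊆ parabolicCylinder R z →
      ∃ V : ℝ → (EuclideanSpace ℝ (Fin 3)) → (EuclideanSpace ℝ (Fin 3)),
        uncurry u =ᵐ[volume.restrict (parabolicCylinder (scale lam / 2) z₀)] uncurry V ∧
        (∀ w ∈ parabolicCylinder (scale lam / 2) z₀, ContDiffAt ℝ ∞ (V w.1) w.2) ∧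
        (∀ k : ℕ, ∃ C α : ℝ≥0, 0 < α ∧
          HolderOnWith C α (fun w : ℝ × (EuclideanSpace ℝ (Fin 3)) => iteratedFDeriv ℝ k (V w.1) w.2)
            (parabolicCylinder (scale lam / 2) z₀)) ∧
        ∀ k : ℕ, ∀ w ∈ parabolicCylinder (scale lam / 2) z₀,
          ‖iteratedFDeriv ℝ k (V w.1) w.2‖ ≤ (scale lam)⁻¹ ^ (k + 1) * c₀ k := by
    intro lam hlam z₀ hz₀
    have hρ := hscale_pos lam hlam
    have h4 := hscale_le lam hlam
    -- suitability in the ball of radius `scale lam`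
    have hpar : parCyl z₀ (2 * scale lam) ⊆ parabolicCylinder R z :=
      (parCyl_two_mul_subset hρ h4).trans hz₀
    have hball := isSuitableWeakSolutionInBall_of_bounded hsuit hG hbd hp hρ hpar
    -- smallness at the scale
    have hsub4 : parabolicCylinder (lam / 4) z₀ ⊆ parabolicCylinder R z :=
      (parabolicCylinder_mono_radius (by positivity) (by linarith) z₀).trans hz₀
    have hCk : ∀ k, cknC (lam * ((epsHalfScale σ k : ℝ≥0) : ℝ) ^ 2) z₀ u ≤
        ((aC lam * epsHalfScale σ k : ℝ≥0) : ℝ≥0∞) := by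
      intro k
      obtain ⟨hs0, hs4⟩ := epsHalfScale_pos_sq_le hσ0 hσ1 k
      set s : ℝ := ((epsHalfScale σ k : ℝ≥0) : ℝ) with hs
      have hs1 : s ≤ 1 := by nlinarith
      have hsubk : parabolicCylinder (lam * s ^ 2) z₀ ⊆ parabolicCylinder R z :=
        (parabolicCylinder_mono_radius (by positivity) (by nlinarith) z₀).trans hz₀
      refine (cknC_le_of_ae_bound_subset hM'0 hbd' (by positivity) hsubk).trans ?_
      -- `M'³ (λ s²)³ |B₁| ≤ M'³ λ³ s |B₁|`
      have hle : M' ^ 3 * (lam * s ^ 2) ^ 3 ≤ M' ^ 3 * lam ^ 3 * s := by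
        have hs6 : s ^ 6 ≤ s := by
          have h5 : s ^ 5 ≤ 1 := pow_le_one₀ hs0.le hs1
          nlinarith
        have h0 : 0 ≤ M' ^ 3 * lam ^ 3 := by positivity
        nlinarith
      calc ENNReal.ofReal (M' ^ 3 * (lam * s ^ 2) ^ 3) * B₁
          ≤ ENNReal.ofReal (M' ^ 3 * lam ^ 3 * s) * B₁ :=
            mul_le_mul' (ENNReal.ofReal_le_ofReal hle) le_rfl
        _ = ((aC lam * epsHalfScale σ k : ℝ≥0) : ℝ≥0∞) := by
            have e : ENNReal.ofReal s = ((epsHalfScale σ k : ℝ≥0) : ℝ≥0∞) := by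
              rw [hs, ENNReal.ofReal_coe_nnreal]
            rw [ENNReal.ofReal_mul (by positivity), e, ENNReal.coe_mul]
            simp only [haC]
            rw [ENNReal.coe_mul, ENNReal.coe_toNNReal hB₁top, mul_right_comm]
            rfl
    have hDle : cknD (lam / 4) z₀ p ≤ D₀ lam := by
      have hfin : (ENNReal.ofReal (lam / 4) ^ 2)⁻¹ * Pp ≠ ⊤ :=
        ENNReal.mul_ne_top
          (ENNReal.inv_ne_top.2 (ENNReal.pow_pos (ENNReal.ofReal_pos.2 (by positivity)) 2).ne') hp.ne
      simp only [hD₀]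
      rw [ENNReal.coe_toNNReal hfin]
      exact cknD_le_inv_sq_mul_lintegral hsub4
    have hsmall := cknC_add_cknD_le_of_decay hdecay hσ0 hσ1 hcσ hη0 hlam hsub4 hCk hDle
    exact exists_smooth_representative_of_small h61 hρ hball (hsmall.trans_lt hηε)
  -- one continuous representative on `Q(z, R)`
  have hglue : ∀ w ∈ parabolicCylinder R z, ∃ T : Set (ℝ × (EuclideanSpace ℝ (Fin 3))), IsOpen T ∧ w ∈ T ∧
      T ⊆ parabolicCylinder R z ∧ ∃ g : ℝ × (EuclideanSpace ℝ (Fin 3)) → (EuclideanSpace ℝ (Fin 3)), ContinuousOn g T ∧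
        uncurry u =ᵐ[volume.restrict T] g := by
    intro w hw
    obtain ⟨r, hr, hwr⟩ := exists_mem_parabolicCylinder_lt hw
    have hlam : 0 < (R - r) / 2 := by linarith [hr.2]
    have hρ : 0 < scale ((R - r) / 2) := hscale_pos _ hlam
    have haQ : parabolicCylinder ((R - r) / 2)
        (min (w.1 + scale ((R - r) / 2) ^ 2 / 8) z.1, w.2) ⊆ parabolicCylinder R z :=
      anchor_subset hr (parabolicCylinder_subset_Icc_prod_closedBall z r hwr) _
    obtain ⟨V, hae, -, hHol, -⟩ := key _ hlam _ haQ
    obtain ⟨C, α, hα, hH0⟩ := hHol 0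
    have hT : parabolicCylinder (scale ((R - r) / 2) / 2)
        (min (w.1 + scale ((R - r) / 2) ^ 2 / 8) z.1, w.2) ⊆ parabolicCylinder R z :=
      (parabolicCylinder_mono_radius (by positivity) (by linarith [hscale_le _ hlam]) _).trans haQ
    exact ⟨_, isOpen_parabolicCylinder _ _, mem_parabolicCylinder_anchor hwr hρ, hT, uncurry V,
      continuousOn_uncurry_of_holderOnWith_zero hα hH0, hae⟩
  obtain ⟨g, hg, hug⟩ := exists_continuousOn_ae_eq_of_locally (μ := volume) hglue
  -- it agrees with every local representative on its cylinder
  have hagree : ∀ {T : Set (ℝ × (EuclideanSpace ℝ (Fin 3)))} {W : ℝ → (EuclideanSpace ℝ (Fin 3)) → (EuclideanSpace ℝ (Fin 3))}, IsOpen T → T ⊆ parabolicCylinder R z →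
      uncurry u =ᵐ[volume.restrict T] uncurry W → ContinuousOn (uncurry W) T →
      EqOn (uncurry (curry g)) (uncurry W) T := by
    intro T W hTo hTO hae hWc
    have h1 : (uncurry (curry g)) =ᵐ[volume.restrict T] uncurry W := by
      have h3 : uncurry u =ᵐ[volume.restrict T] g := ae_restrict_of_ae_restrict_of_subset hTO hug
      have h2 : g =ᵐ[volume.restrict T] uncurry W := h3.symm.trans hae
      simpa using h2
    refine Measure.eqOn_open_of_ae_eq h1 hTo ?_ hWc
    simpa using hg.mono hTO
  refine ⟨curry g, by simpa using hug, fun w hw => ?_, fun n r hr => ?_⟩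
  · -- smooth slices
    obtain ⟨r, hr, hwr⟩ := exists_mem_parabolicCylinder_lt hw
    have hlam : 0 < (R - r) / 2 := by linarith [hr.2]
    have hρ : 0 < scale ((R - r) / 2) := hscale_pos _ hlam
    have haQ : parabolicCylinder ((R - r) / 2)
        (min (w.1 + scale ((R - r) / 2) ^ 2 / 8) z.1, w.2) ⊆ parabolicCylinder R z :=
      anchor_subset hr (parabolicCylinder_subset_Icc_prod_closedBall z r hwr) _
    obtain ⟨W, hae, hcd, hHol, -⟩ := key _ hlam _ haQ
    obtain ⟨C, α, hα, hH0⟩ := hHol 0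
    have hT : parabolicCylinder (scale ((R - r) / 2) / 2)
        (min (w.1 + scale ((R - r) / 2) ^ 2 / 8) z.1, w.2) ⊆ parabolicCylinder R z :=
      (parabolicCylinder_mono_radius (by positivity) (by linarith [hscale_le _ hlam]) _).trans haQ
    have hwT := mem_parabolicCylinder_anchor hwr hρ
    have heq := hagree (isOpen_parabolicCylinder _ _) hT hae
      (continuousOn_uncurry_of_holderOnWith_zero hα hH0)
    exact contDiffAt_of_eqOn (isOpen_parabolicCylinder _ _) heq hwT (hcd w hwT)
  · -- uniform Hölder bounds on `Q(z, r)`: anchors from the closed box, at the uniform scale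
    have hlam : 0 < (R - r) / 2 := by linarith [hr.2]
    set ρ : ℝ := scale ((R - r) / 2) with hρdef
    have hρ : 0 < ρ := hscale_pos _ hlam
    have hρle : ρ / 2 ≤ (R - r) / 2 := by linarith [hscale_le _ hlam]
    refine exists_holderOnWith_of_locally (isCompact_Icc.prod (isCompact_closedBall _ _))
      (parabolicCylinder_subset_Icc_prod_closedBall z r) (B := ρ⁻¹ ^ (n + 1) * c₀ n) ?_ ?_
    · -- the uniform bound on `Q(z, r)`
      intro w hwr
      have haQ : parabolicCylinder ((R - r) / 2) (min (w.1 + ρ ^ 2 / 8) z.1, w.2) ⊆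
          parabolicCylinder R z :=
        anchor_subset hr (parabolicCylinder_subset_Icc_prod_closedBall z r hwr) ρ
      obtain ⟨W, hae, -, hHol, hbW⟩ := key _ hlam _ haQ
      obtain ⟨C, α, hα, hH0⟩ := hHol 0
      have hT : parabolicCylinder (ρ / 2) (min (w.1 + ρ ^ 2 / 8) z.1, w.2) ⊆
          parabolicCylinder R z :=
        (parabolicCylinder_mono_radius (by positivity) hρle _).trans haQ
      have hwT : w ∈ parabolicCylinder (ρ / 2) (min (w.1 + ρ ^ 2 / 8) z.1, w.2) :=
        mem_parabolicCylinder_anchor hwr hρ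
      have heq := hagree (isOpen_parabolicCylinder _ _) hT hae
        (continuousOn_uncurry_of_holderOnWith_zero hα hH0)
      rw [iteratedFDeriv_slice_eq_of_eqOn (isOpen_parabolicCylinder _ _) heq n hwT]
      exact hbW n w hwT
    · -- local Hölder bounds around the points of the box
      intro q hq
      have haQ : parabolicCylinder ((R - r) / 2) (min (q.1 + ρ ^ 2 / 8) z.1, q.2) ⊆
          parabolicCylinder R z := anchor_subset hr hq ρ
      obtain ⟨W, hae, -, hHol, -⟩ := key _ hlam _ haQ
      obtain ⟨C₀, α₀, hα₀, hH0⟩ := hHol 0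
      obtain ⟨C, α, hα, hHn⟩ := hHol n
      have hT : parabolicCylinder (ρ / 2) (min (q.1 + ρ ^ 2 / 8) z.1, q.2) ⊆
          parabolicCylinder R z :=
        (parabolicCylinder_mono_radius (by positivity) hρle _).trans haQ
      have heq := hagree (isOpen_parabolicCylinder _ _) hT hae
        (continuousOn_uncurry_of_holderOnWith_zero hα₀ hH0)
      have hsub := anchor_nhds_inter_subset (z := z) (r := r) (q := q) ρ
      exact ⟨_, isOpen_Ioo.prod isOpen_ball, mem_anchor_nhds q hρ, C, α, hα,
        holderOnWith_iteratedFDeriv_of_eqOn (isOpen_parabolicCylinder _ _) heq n hsub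
          fun x hx y hy => hHn x (hsub hx) y (hsub hy)⟩

end Main

end Literature.Analysis.FluidPDE

end
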